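import Summits.BirchSwinnertonDyer.BirchSwinnertonDyer.Theorems.ClassRecordThreeEulerHalvesAtThreeCartanCarayolCut
import Literature.NumberTheory.EllipticCurves.TorsionLevelLoweringGoodReductionProofs
import Literature.NumberTheory.EllipticCurves.NewformGaloisRepResidualOfThm61Proofs
import Literature.NumberTheory.EllipticCurves.ModularJacobianNormImageSerreWeightProofs
import Literature.NumberTheory.GaloisRepresentations.DiscreteRepFrobeniusSeparation
import Literature.NumberTheory.Automorphic.BCDTTheoremB
import Literature.NumberTheory.Automorphic.BCDTModularitySerreProofs
import Literature.NumberTheory.Automorphic.BCDTModularityModPProofs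
import Literature.NumberTheory.EllipticCurves.DivisionTowerH1OrderTwoFrames
import Literature.NumberTheory.EllipticCurves.HasseWeilGoodReductionProofs
import Literature.NumberTheory.EllipticCurves.HasseWeilGoodReduction
import Literature.NumberTheory.EllipticCurves.GoodReductionUnramifiedProofs
import Literature.NumberTheory.GaloisRepresentations.DecomposedGenericOfQuadratic
import HarnessLib

/-!
# Crux NUM `CartanOnePlaceDegreeLawAtThree` (stmt-BirchSwinnertonDyer-24801) ∕ `EulerHalvesAtThree` (19109) — THE GALOIS LEAF IN MODULARITY AND IN
# AUTOMORPHIC CURRENCY, Theorems level.  Ideator `bsd-idea-10` g19 (lens = transfer).  Statements BYTE-IDENTICAL to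
# `Cruxes/EulerHalvesAtThree/Lines/cartan_carayol.lean` r3 §1, §3–§5 (minus the stub §6).

(OBS) `CartanCover.Charext.NoModThreePeriodCharacterExtension` (p738423) — the ONE Galois statement modulo which `Lines/lattice` v7 closes NUM —
and its Carayol cut (CAR) `CartanCarayol.CarayolUnramifiedAtThree` (p739037) follow from either of two `Prop`s DEFINED here (nothing asserted):
* (MOD) `ModularOfLevelPrimeToCartanPlaceAtThree`: under CAR's hypotheses (a mod-`3Λ` quasi-homomorphic extension `χ` of the scaled period
  character `c·per_F` from `Γ̄(q) = principalLevel X q` to `ι(O₀'¹) = coverUnits X q`, non-zero mod `3Λ` on `Γ̄(q)`), some framed model `ρ̄` of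
  `V[3]` base-changed along some `j : 𝔽₃ → k` satisfies `IsGaloisRepOfNewform1Int f ι_f {ℓ ∣ 3 M_f} (ρ̄ ⊗ k)` for a cusp form `f ∈ S_w(Γ₁(M_f))`
  with `q ∤ M_f` — «`ρ̄_{V,3}` is modular of level prime to `q`» (shape of `ModPGaloisRep.IsModular` + the level constraint);
* (CONG) `CongruentNewformOfLevelPrimeToCartanPlaceAtThree`: same hypotheses, conclusion «there are a weight-2 NEWFORM `f ∈ S₂(Γ₁(M_f))`,
  `q ∤ M_f`, and a prime `λ ∣ 3` of its coefficient ring (`ι_f : 𝓞_f → k ⊇ j(𝔽₃)`) with `ι_f(X² − a_v(f) X + ε_f(v) v) = X² − j(a_v(V)) X + j(#k_v)`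
  for all but finitely many places `v`» — PURELY AUTOMORPHIC (+ point counts of `V`), no Galois representation mentioned: the literal output of
  [res-injectivity `Hom(SL₂(𝔽_q), 𝔽₃) = 0` (tree `…InertHecke.modThree_trivial_of_trivial_on_principalLevel`) ⇒ the extension is unique, hence a
  `T_ℓ`-eigenclass with eigenvalues `a_ℓ(V) mod 3`] + [Deligne–Serre, Lemme 6.11] + [Jacquet–Langlands from `X_{O₀'}` (discriminant `D`, level prime
  to `q`) to `GL₂`] + [Atkin–Lehner–Li, tree `exists_isNewform1_of_eigenpacket`].
PROVED here, sorry-free, from TREE theorems only: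
* `modular_of_congruentNewform : DeligneSerre1974.thm61_exists_adicGaloisRep → CONG → MOD` — Deligne's theorem enters as the tree's NAMED FACT
  (hypothesis); then `exists_isGaloisRepOfNewform1Int_semisimple_of_thm61` (ρ̄_{f,λ}), `Surj V 3` ⇒ `ρ̄_{V,3} ⊗ k` irreducible ⇒ semisimple
  (`BCDT.isAbsIrreducibleOverSqrt_neg_three_of_surjective`, `FramedRep.IsAbsolutelyIrreducible.isIrreducible_baseChange`,
  `LawsonWuthrich2016.exists_rep_eq_of_hasSurjectiveModNGaloisRep`), the Frobenius polynomials of `V[3]`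
  (`IsTorsionGaloisRep.charpoly_eq_of_isArithFrobAt`, `trace_∕det_galoisRepTate_frobenius_of_hasGoodReductionAt_holds`), Čebotarev + Brauer–Nesbitt
  (`FramedGaloisRep.nonempty_equiv_of_hasFrobCharpolyAt_eventually_of_discrete'`, unconditional) and transport (`IsGaloisRepOfNewform1Int.of_equiv`);
* `carayol_of_modular : MOD → CAR` (`FramedGaloisRep.isUnramifiedAt_baseChange_iff`; `inertia_adicCompletionPrime_eq_map_absInertia` = «`GreenbergSelmer.inertia v`
  is the inertia group of `𝔓₀ = adicCompletionPrime ℚ v`»; the frame is injective);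
* `noModThreePeriodCharacterExtension_of_modular : MOD → OBS` (directly: the Cartan place is ADDITIVE, `CartanCarayol.hasAdditiveReductionAt_of_mem_cartanPlaces`
  (RAM, p736694), and `WeierstrassCurve.IsTorsionGaloisRep.not_isUnramifiedAt_baseChange_of_hasAdditiveReductionAt` (Silverman VII.6.1) — the argument of the
  tree's `WeierstrassCurve.dvd_of_isGaloisRepOfNewform1Int_of_hasAdditiveReductionAt`); `…_of_modular'` through CAR and `noModThreePeriodCharacterExtension_of_carayol`;
* `…_of_congruentNewform`, `saturationAtThree_of_modular ∕ _of_congruentNewform : (M) → (M0) → MOD ∕ (Deligne → CONG) → CartanCover.SaturationAtThree`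
  (via the LEAD's `Charext.saturationAtThree_of_leaves`, p738423);
* bookkeeping at the place over `q` (`three_not_mem_of_natCast_mem`, `primesEquiv_not_mem_dvd_mul_three`); the critic's N2
  (`¬ q³ ∣ N` follows from `CartanLevelCurveData.coprime`, so dropping it is truth-safe) is kernel-checked as `not_cube_dvd_of_mem_cartanPlaces` in the work-file r3.
LOGICAL STATUS: OBS ⟸ CAR ⟸ MOD ⟸ (Deligne ∧ CONG), each arrow a theorem of this file ∕ p739037; modulo RAM, CAR ⟺ OBS with five hypotheses deleted
(critic V198 N1: a reshaping + strengthening, not a factorisation), MOD and CONG strengthen further by naming the reason.  USE: by-name sockets for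
the Hecke side — whoever proves «eigenclass on `coverUnits X q` ⇒ CONG» (Deligne–Serre lifting + Jacquet–Langlands typing; `Lines/charext` of
cruxidea-24801-1) closes OBS by `exact CartanCarayol.noModThreePeriodCharacterExtension_of_congruentNewform h61 ‹CONG›`.
HONEST: two `Prop` definitions (asserted nowhere) and sorry-free implications; nothing is proved about any curve's `L`-value; OBS ∕ CAR ∕ MOD ∕ CONG ∕
24801 ∕ 23422 ∕ 19109 open; no summit statement is proved; BSD is proved for no curve.
[cite: Carayol1989, Thm. (A)] [cite: Carayol1986, Thm. (A)] [cite: DeligneSerre1974, Thm. 6.1, Lemme 3.2, Lemme 6.11 and §6] [cite: DiamondTaylor1994, Thm. 1 and §1]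
[cite: Serre1987, §1.2, (1.2.1)–(1.2.2)] [cite: SilvermanAEC2009, Thm. VII.6.1, C.21 Remark 21.3] [cite: Edixhoven1997, §4.4] [cite: BCDTJAMS2001, Introduction]
[cite: DarmonDiamondTaylor1995, §2.1 and p. 87] [cite: DiamondShurman2005, Thm. 5.8.2–5.8.3, Thm. 9.6.5]
-/

set_option linter.dupNamespace false
set_option autoImplicit false

noncomputable section

open scoped Classical MatrixGroups ModularForm NumberField

namespace Summit.BirchSwinnertonDyer.BirchSwinnertonDyer.Theorems.CartanCarayol

open Summit.BirchSwinnertonDyer.BirchSwinnertonDyer.Theorems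
open Literature.NumberTheory.Automorphic WeierstrassCurve Literature.NumberTheory.EllipticCurves
  Literature.NumberTheory.EllipticCurves.Rank1Residual Summit.BirchSwinnertonDyer.Rank1Residual
open Literature.NumberTheory.GaloisRepresentations Literature.NumberTheory.EllipticCurves.ModularForms
open NumberField IsDedekindDomain CongruenceSubgroup Rat.HeightOneSpectrum

/-! ## §1 (MOD) The Galois leaf in modularity currency (a `Prop`, nothing asserted) -/

/-- **(MOD) `ρ̄_{V,3}` IS MODULAR OF LEVEL PRIME TO THE CARTAN PLACE `q`** [PRINT CONTENT; the Galois leaf of NUM in the currency of the tree's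
level-optimisation theorems]. Binders and hypotheses = those of (CAR) `CartanCarayol.CarayolUnramifiedAtThree` VERBATIM (`V/ℚ` with `ρ̄_{V,3}` surjective;
Cartan datum `X` of level `(D, M; C)` with `N(V) = D·M·∏_{p∈C} p²`; `q ∈ C`, `q ≠ 3`; class-minimal parametrisation data `Q` of `W₁ ~ V` on `X`; a
`Λ(W₁)`-valued `χ` on `GL₂(ℝ)`, quasi-homomorphic mod `3Λ` on `coverUnits X q = ι(O₀'¹)`, `≡ c·per_F (mod 3Λ)` on `principalLevel X q = Γ̄(q)`, with
`c·per_F ≢ 0 (mod 3Λ)` there); conclusion: there are a framed model `ρ̄ : Γ_ℚ →ₜ* GL₂(𝔽₃)` of `V[3]` (`V.IsTorsionGaloisRep 3 ρ̄`), a level `M_f` with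
`q ∤ M_f`, a cusp form `f ∈ S_w(Γ₁(M_f))`, a discrete field `k` with `j : 𝔽₃ →+* k` and `ι_f : 𝓞_f →+* k`, such that
`IsGaloisRepOfNewform1Int f ι_f {ℓ ∣ M_f·3} (ρ̄ ⊗_j k)` (unramified at every `ℓ ∤ 3 M_f` with Frobenius characteristic polynomials those of `f` mod `λ`) — the
shape of `ModPGaloisRep.IsModular` with the level constraint `q ∤ M_f` added and `IsNewform1 f`, `1 ≤ w` dropped (not needed downstream; print gives them,
with `w = 2` and `M_f ∣ D·M·∏_{p ∈ C∖q} p²`). Route to it: see the module docstring (res-injectivity ⇒ eigenclass; Deligne–Serre; Jacquet–Langlands at level prime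
to `q`; Eichler–Shimura–Deligne; Brauer–Nesbitt–Čebotarev). Why it might fail: it should not (each print step is a theorem); the risk is TYPING the Hecke side
(`Hom(coverUnits X q, Λ∕3Λ)` as a Hecke module, its eigenclasses, the mod-3 Deligne–Serre∕Jacquet–Langlands transfer for Cartan-level quaternionic groups).
Its hypotheses are never met by an actual `V` (RAM) — an OBSTRUCTION statement valued for its shape. [cite: DeligneSerre1974, Lemme 6.11 and §6]
[cite: Carayol1986, Thm. (A)] [cite: DiamondTaylor1994, Thm. 1 and §1] [cite: BCDTJAMS2001, Introduction] [cite: Serre1987, §1.2 and (3.2.3)] -/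
@[conjecture]
def ModularOfLevelPrimeToCartanPlaceAtThree : Prop :=
  ∀ (V : WeierstrassCurve ℚ) [V.IsElliptic], Surj V 3 →
    ∀ (N D M : ℕ) (C : Finset ℕ) (q : ℕ) [Fact q.Prime]
      (X : CartanLevelCurveData D M C) (W₁ : WeierstrassCurve ℚ) [W₁.IsElliptic] (Q : CartanParametrizationData X W₁),
      q ∈ C → V.conductorNorm ℤ = N → D * M * ∏ p ∈ C, p ^ 2 = N → q ≠ 3 → Q.IsMinimalFor V →
      ∀ (c : ℂ) (χ : GL (Fin 2) ℝ → ℂ),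
        (∀ γ ∈ CartanCover.coverUnits X q, χ γ ∈ Q.L.lattice) →
        (∀ γ ∈ CartanCover.coverUnits X q, ∀ δ ∈ CartanCover.coverUnits X q,
          ∃ y ∈ Q.L.lattice, χ (γ * δ) - χ γ - χ δ = 3 * y) →
        (∀ β ∈ CartanCover.principalLevel X q,
          ∃ y ∈ Q.L.lattice, χ β - c * segmentIntegral (⇑Q.form) Q.basePoint (β • Q.basePoint) = 3 * y) →
        (¬ ∀ β ∈ CartanCover.principalLevel X q,
          ∃ y ∈ Q.L.lattice, c * segmentIntegral (⇑Q.form) Q.basePoint (β • Q.basePoint) = 3 * y) →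
        ∃ (ρ : FramedGaloisRep ℚ (ZMod 3) 2) (_ : V.IsTorsionGaloisRep 3 ρ)
          (Mf : ℕ) (_ : NeZero Mf) (w : ℤ) (f : CuspForm (Gamma1 Mf) w)
          (k : Type) (_ : Field k) (_ : TopologicalSpace k) (_ : DiscreteTopology k)
          (j : ZMod 3 →+* k) (ιf : coeffCharIntegers f →+* k),
          ¬ q ∣ Mf ∧
            IsGaloisRepOfNewform1Int f ιf {ℓ | ℓ ∣ Mf * 3} (FramedRep.baseChange j continuous_of_discreteTopology ρ)

/-! ## §3 Bookkeeping at the place over `q` -/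

/-- At a place `v ∋ q`, `q ≠ 3`, the prime `3` is a unit: `3 ∉ v`. [folklore] -/
theorem three_not_mem_of_natCast_mem {q : ℕ} (hq : q.Prime) (hq3 : q ≠ 3) {v : HeightOneSpectrum (𝓞 ℚ)} (hv : (q : 𝓞 ℚ) ∈ v.asIdeal) :
    ((3 : ℕ) : 𝓞 ℚ) ∉ v.asIdeal := fun h3 ↦
  hq3 ((Rat.natGenerator_eq_of_natCast_mem hq hv).symm.trans (Rat.natGenerator_eq_of_natCast_mem Nat.prime_three h3))

/-- At a place `v ∋ q` with `q ∤ M_f`, `q ≠ 3`: `ℓ_v ∉ {ℓ ∣ M_f · 3}` (the exceptional set of `IsGaloisRepOfNewform1Int`). [folklore] -/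
theorem primesEquiv_not_mem_dvd_mul_three {q : ℕ} (hq : q.Prime) (hq3 : q ≠ 3) {Mf : ℕ} (hqMf : ¬ q ∣ Mf) {v : HeightOneSpectrum (𝓞 ℚ)}
    (hv : (q : 𝓞 ℚ) ∈ v.asIdeal) : ((primesEquiv v : Nat.Primes) : ℕ) ∉ {ℓ | ℓ ∣ Mf * 3} := by
  change ¬ natGenerator v ∈ {ℓ | ℓ ∣ Mf * 3}
  rw [Set.mem_setOf_eq, Rat.natGenerator_eq_of_natCast_mem hq hv]
  intro h'
  rcases (Nat.Prime.dvd_mul hq).mp h' with h1 | h1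
  · exact hqMf h1
  · exact hq3 ((Nat.prime_dvd_prime_iff_eq hq Nat.prime_three).mp h1)

/-! ## §4 The cuts (PROVED): MOD ⟹ CAR, MOD ⟹ OBS, and (D4) re-hung on MOD -/

/-- **CAR from MOD.** If `ρ̄_{V,3} ⊗ k` is carried by a cusp form of level `M_f` prime to `q` (`IsGaloisRepOfNewform1Int`, unramified outside `3 M_f`), then
`ρ̄_{V,3}` is unramified at the place `v ∋ q` (`isUnramifiedAt_baseChange_iff`), i.e. the inertia group `I_v = I_{𝔓₀}` (`GreenbergSelmer.inertia`,
`inertia_adicCompletionPrime_eq_map_absInertia`) maps to `1`, i.e. fixes `V[3](ℚ̄)` pointwise (the frame is injective). [cite: Serre1987, §1.2] [cite: SilvermanCSS1997, §7] -/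
theorem carayol_of_modular (hMOD : ModularOfLevelPrimeToCartanPlaceAtThree) : CarayolUnramifiedAtThree := by
  intro V _ hS N D M C q _ X W₁ _ Q hq hN hDMC hq3 hmin c χ hχΛ hχadd hχres hne v hv σ hσ P
  obtain ⟨ρ, hρ, Mf, _, w, f, k, _, _, _, j, ιf, hqMf, hgal⟩ :=
    hMOD V hS N D M C q X W₁ Q hq hN hDMC hq3 hmin c χ hχΛ hχadd hχres hne
  have hqp : q.Prime := Fact.out
  -- `ρ̄ ⊗ k`, hence `ρ̄`, is unramified at `v`
  have hunr : FramedGaloisRep.IsUnramifiedAt v ρ :=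
    (FramedGaloisRep.isUnramifiedAt_baseChange_iff j continuous_of_discreteTopology j.injective v ρ).mp
      (hgal v (primesEquiv_not_mem_dvd_mul_three hqp hq3 hqMf hv)).1
  -- `I_v` is the inertia group of `𝔓₀ = adicCompletionPrime ℚ v`
  have hσ' : σ ∈ (adicCompletionPrime ℚ v).inertia (Field.absoluteGaloisGroup ℚ) := by
    rw [inertia_adicCompletionPrime_eq_map_absInertia]
    exact hσ
  have h1 : ρ σ = 1 := hunr _ (adicCompletionPrime_mem_primesAbove ℚ v) σ hσ'
  -- `ρ̄(σ) = 1` means `σ` fixes `V[3]` pointwise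
  obtain ⟨e, he⟩ := hρ
  apply e.injective
  rw [he σ P, h1, Units.val_one, Matrix.one_mulVec]

/-- **OBS from MOD**, directly (no detour through `GreenbergSelmer.inertia`): the place over the Cartan prime `q` is ADDITIVE for `V`
(`CartanCarayol.hasAdditiveReductionAt_of_mem_cartanPlaces`, RAM), so NO framed model of `V[3]`, base-changed along any field map, is unramified there
(`IsTorsionGaloisRep.not_isUnramifiedAt_baseChange_of_hasAdditiveReductionAt`, Silverman VII.6.1) — contradicting MOD's newform of level prime to `q`.
The same argument is the tree's `WeierstrassCurve.dvd_of_isGaloisRepOfNewform1Int_of_hasAdditiveReductionAt`. [cite: Serre1987, §1.2, (1.2.1)–(1.2.2)]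
[cite: SilvermanAEC2009, Thm. VII.6.1] -/
theorem noModThreePeriodCharacterExtension_of_modular (hMOD : ModularOfLevelPrimeToCartanPlaceAtThree) :
    CartanCover.Charext.NoModThreePeriodCharacterExtension := by
  intro V _ _ hX hS N D M C q _ X W₁ _ Q hq hN hDMC hq3 hq3N hc3 hmin hq1 c χ hχΛ hχadd hχres
  by_contra hne
  obtain ⟨ρ, hρ, Mf, _, w, f, k, _, _, _, j, ιf, hqMf, hgal⟩ :=
    hMOD V hS N D M C q X W₁ Q hq hN hDMC hq3 hmin c χ hχΛ hχadd hχres hne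
  have hqp : q.Prime := Fact.out
  -- the place of `𝓞 ℚ` over `q`
  have hv := CartanCarayol.natCast_mem_asIdeal_primesEquiv_symm hqp
  have hadd := CartanCarayol.hasAdditiveReductionAt_of_mem_cartanPlaces V hq hN hDMC _ hv
  exact hρ.not_isUnramifiedAt_baseChange_of_hasAdditiveReductionAt hadd le_rfl (three_not_mem_of_natCast_mem hqp hq3 hv) j
    continuous_of_discreteTopology (hgal _ (primesEquiv_not_mem_dvd_mul_three hqp hq3 hqMf hv)).1

/-- OBS from MOD, second proof: through CAR (`carayol_of_modular`) and the tree cut `CartanCarayol.noModThreePeriodCharacterExtension_of_carayol` (p739037). -/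
theorem noModThreePeriodCharacterExtension_of_modular' (hMOD : ModularOfLevelPrimeToCartanPlaceAtThree) :
    CartanCover.Charext.NoModThreePeriodCharacterExtension :=
  noModThreePeriodCharacterExtension_of_carayol (carayol_of_modular hMOD)

/-- **(D4) `SaturationAtThree` re-hung on MOD**: from (M) `PeriodLatticeCharacter`, (M0) `Charext.StrongApproxAtCartanPlace` and MOD, via the LEAD's
`Charext.saturationAtThree_of_leaves` (p738423). [cite: DiamondTaylor1994, Thm. 1] -/
theorem saturationAtThree_of_modular (hM : CartanCover.PeriodLatticeCharacter) (hM0 : CartanCover.Charext.StrongApproxAtCartanPlace)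
    (hMOD : ModularOfLevelPrimeToCartanPlaceAtThree) : CartanCover.SaturationAtThree :=
  CartanCover.Charext.saturationAtThree_of_leaves hM hM0 (noModThreePeriodCharacterExtension_of_modular hMOD)


/-! ## §5 (CONG) One notch further: the leaf in PURELY AUTOMORPHIC currency — a congruent newform of level prime to `q` -/

/-- **(CONG) `CongruentNewformOfLevelPrimeToCartanPlaceAtThree`** — the Galois leaf of NUM with the Galois
representations REMOVED [print content, nothing asserted].  Binders and hypotheses VERBATIM those of (MOD) ∕ (CAR);
conclusion: there are a level `M_f` with `q ∤ M_f`, a weight-2 NEWFORM `f ∈ S₂(Γ₁(M_f))` (`IsNewform1 f`), a field `k`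
(discrete) receiving `j : 𝔽₃ → k` and a coefficient map `ι_f : 𝓞_f → k` (a prime `λ ∣ 3` of the coefficient ring
together with an embedding of its residue field), such that FOR ALL BUT FINITELY MANY finite places `v` of `ℚ` the
integral Hecke polynomial `P_v ∈ 𝓞_f[X]` of `f` (`P_v ↦ X² − a_v(f) X + ε_f(v) v` in `K_f[X]`) reduces under `ι_f` to
`X² − j(a_v(V) mod 3) X + j(#k_v mod 3)` — "`f` is congruent to `V` modulo `λ`": `a_ℓ(f) ≡ a_ℓ(V)`, `ε_f(ℓ) ℓ ≡ ℓ (mod λ)`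
for almost all primes `ℓ` (`a_v(V) = V.frobeniusTraceAt v`, `#k_v = Nat.card` of the residue field at `v`, the shape
of the tree's `WeierstrassCurve.IsTorsionGaloisRep.charpoly_eq_of_isArithFrobAt`).  This is the literal output of
[res-injectivity ⇒ the extension `χ̄` is a non-zero `T_ℓ`-eigenclass in `H¹(ι(O₀'¹), Λ∕3Λ)` with eigenvalues
`a_ℓ(V) mod 3`] + [Deligne–Serre, Lemme 6.11: lift the eigenvalue system to characteristic `0` in the (torsion-free)
weight-2 Hecke module of `X_{O₀'} = ι(O₀'¹)∖ℍ`] + [Jacquet–Langlands (Shimizu ∕ JL 1970 §16; cf. Diamond–Taylor 1994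
§1–§4, Ribet 1990 "switch to the Shimura curve"): the same eigenvalue system occurs on a newform `f` on `GL₂` of level
`M_f ∣ D·(level of O₀')`, prime to `q`] + [Atkin–Lehner–Li, in the tree: `exists_isNewform1_of_eigenpacket`] — and
NOTHING ELSE: no Galois representation is mentioned.  The tree supplies the rest
(`modular_of_congruentNewform` below: Deligne's theorem as the named fact `DeligneSerre1974.thm61_exists_adicGaloisRep`,
its mod-`λ` reduction `exists_isGaloisRepOfNewform1Int_semisimple_of_thm61`, Čebotarev + Brauer–Nesbitt
`FramedGaloisRep.nonempty_equiv_of_hasFrobCharpolyAt_eventually_of_discrete'`, transport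
`IsGaloisRepOfNewform1Int.of_equiv`, and `E[3]`'s Frobenius polynomials `IsTorsionGaloisRep.charpoly_eq_of_isArithFrobAt`).
As (CAR) and (MOD) this is an obstruction statement: by (RAM) its hypotheses are never met.
[cite: DeligneSerre1974, Lemme 6.11] [cite: DiamondTaylor1994, Thm. 1, §1–§4] [cite: Ribet1990, Thm. 1.1 (switch to Shimura curves)]
[cite: DiamondShurman2005, Thm. 5.8.2–5.8.3, Thm. 9.6.5] -/
@[conjecture]
def CongruentNewformOfLevelPrimeToCartanPlaceAtThree : Prop :=
  ∀ (V : WeierstrassCurve ℚ) [V.IsElliptic], Surj V 3 →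
    ∀ (N D M : ℕ) (C : Finset ℕ) (q : ℕ) [Fact q.Prime]
      (X : CartanLevelCurveData D M C) (W₁ : WeierstrassCurve ℚ) [W₁.IsElliptic] (Q : CartanParametrizationData X W₁),
      q ∈ C → V.conductorNorm ℤ = N → D * M * ∏ p ∈ C, p ^ 2 = N → q ≠ 3 → Q.IsMinimalFor V →
      ∀ (c : ℂ) (χ : GL (Fin 2) ℝ → ℂ),
        (∀ γ ∈ CartanCover.coverUnits X q, χ γ ∈ Q.L.lattice) →
        (∀ γ ∈ CartanCover.coverUnits X q, ∀ δ ∈ CartanCover.coverUnits X q,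
          ∃ y ∈ Q.L.lattice, χ (γ * δ) - χ γ - χ δ = 3 * y) →
        (∀ β ∈ CartanCover.principalLevel X q,
          ∃ y ∈ Q.L.lattice, χ β - c * segmentIntegral (⇑Q.form) Q.basePoint (β • Q.basePoint) = 3 * y) →
        (¬ ∀ β ∈ CartanCover.principalLevel X q,
          ∃ y ∈ Q.L.lattice, c * segmentIntegral (⇑Q.form) Q.basePoint (β • Q.basePoint) = 3 * y) →
        ∃ (Mf : ℕ) (_ : NeZero Mf) (f : CuspForm (Gamma1 Mf) 2) (_ : IsNewform1 f)
          (k : Type) (_ : Field k) (_ : TopologicalSpace k) (_ : DiscreteTopology k)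
          (j : ZMod 3 →+* k) (ιf : coeffCharIntegers f →+* k),
          ¬ q ∣ Mf ∧
            ∀ᶠ v : HeightOneSpectrum (𝓞 ℚ) in Filter.cofinite,
              ∃ P : Polynomial (coeffCharIntegers f),
                P.map (algebraMap (coeffCharIntegers f) (coeffCharField f)) =
                    heckePolynomial f (primesEquiv v : Nat.Primes) ∧
                  P.map ιf = Polynomial.X ^ 2 - Polynomial.C (j (V.frobeniusTraceAt v : ZMod 3)) * Polynomial.X +
                    Polynomial.C (j (Nat.card (IsLocalRing.ResidueField (v.adicCompletionIntegers ℚ)) : ZMod 3))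

/-- Surjectivity of `ρ̄_{E,3}` read in a frame: if `Surj V 3` (`V.HasSurjectiveModNGaloisRep 3`) then every framed model
`ρ̄` of `V[3]` is surjective onto `GL₂(𝔽₃)` (tree: `LawsonWuthrich2016.exists_rep_eq_of_hasSurjectiveModNGaloisRep`). [folklore] -/
theorem surjective_of_surj_of_isTorsionGaloisRep {V : WeierstrassCurve ℚ} [V.IsElliptic] (hS : Surj V 3)
    {ρ : FramedGaloisRep ℚ (ZMod 3) 2} (hρ : V.IsTorsionGaloisRep 3 ρ) : Function.Surjective ρ := by
  obtain ⟨e, he⟩ := hρ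
  intro B
  obtain ⟨σ, hσ⟩ := LawsonWuthrich2016.exists_rep_eq_of_hasSurjectiveModNGaloisRep V e
    (ρ : Field.absoluteGaloisGroup ℚ →* GL (Fin 2) (ZMod 3)) (fun σ P ↦ he σ P) hS B
  exact ⟨σ, hσ⟩

/-- A framed model of `V[3]` of a curve with `Surj V 3`, base-changed along any `j : 𝔽₃ → k` (`k` a discrete field), is
semisimple — indeed irreducible: surjective ⇒ absolutely irreducible over `ℚ(√-3)`
(`BCDT.isAbsIrreducibleOverSqrt_neg_three_of_surjective`) ⇒ absolutely irreducible ⇒ every base change irreducible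
(`FramedRep.IsAbsolutelyIrreducible.isIrreducible_baseChange`) ⇒ semisimple. [folklore] -/
theorem isSemisimple_baseChange_of_surj {V : WeierstrassCurve ℚ} [V.IsElliptic] (hS : Surj V 3)
    {ρ : FramedGaloisRep ℚ (ZMod 3) 2} (hρ : V.IsTorsionGaloisRep 3 ρ)
    (k : Type) [Field k] [TopologicalSpace k] [DiscreteTopology k] (j : ZMod 3 →+* k) :
    (FramedGaloisRep.toGaloisRep (K := ℚ) (FramedRep.baseChange j continuous_of_discreteTopology ρ)).IsSemisimple := by
  have hirr := (BCDT.isAbsIrreducibleOverSqrt_neg_three_of_surjective ρ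
    (surjective_of_surj_of_isTorsionGaloisRep hS hρ)).isAbsolutelyIrreducible.isIrreducible_baseChange k j
    continuous_of_discreteTopology
  haveI : Representation.IsIrreducible
      (FramedGaloisRep.toGaloisRep (K := ℚ) (FramedRep.baseChange j continuous_of_discreteTopology ρ)).toRepresentation :=
    hirr
  change ComplementedLattice _
  infer_instance

/-- The Frobenius polynomials of `ρ̄_{V,3} ⊗_j k` at the good places `v ∤ 3`: `X² − j(a_v(V)) X + j(#k_v)` (the tree's
`IsTorsionGaloisRep.charpoly_eq_of_isArithFrobAt`, with the trace ∕ determinant of Frobenius on `T₃ V` now theorems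
`trace_∕det_galoisRepTate_frobenius_of_hasGoodReductionAt_holds`, pushed along `j` by `FramedRep.charpoly_baseChange`).
[cite: SilvermanAEC2009, C.21 Remark 21.3] -/
theorem hasFrobCharpolyAt_baseChange_of_isTorsionGaloisRep {V : WeierstrassCurve ℚ} [V.IsElliptic]
    {ρ : FramedGaloisRep ℚ (ZMod 3) 2} (hρ : V.IsTorsionGaloisRep 3 ρ)
    (k : Type) [Field k] [TopologicalSpace k] [DiscreteTopology k] (j : ZMod 3 →+* k)
    {v : HeightOneSpectrum (𝓞 ℚ)} (hv : V.HasGoodReductionAt v) (h3v : ((3 : ℕ) : 𝓞 ℚ) ∉ v.asIdeal) :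
    FramedGaloisRep.HasFrobCharpolyAt v
      (Polynomial.X ^ 2 - Polynomial.C (j (V.frobeniusTraceAt v : ZMod 3)) * Polynomial.X +
        Polynomial.C (j (Nat.card (IsLocalRing.ResidueField (v.adicCompletionIntegers ℚ)) : ZMod 3)))
      (FramedRep.baseChange j continuous_of_discreteTopology ρ) := by
  intro 𝔓 h𝔓 σ hσ
  rw [FramedRep.charpoly_baseChange]
  unfold FramedRep.charpoly
  rw [hρ.charpoly_eq_of_isArithFrobAt (V.trace_galoisRepTate_frobenius_of_hasGoodReductionAt_holds 3)
    (V.det_galoisRepTate_frobenius_of_hasGoodReductionAt_holds 3) h3v hv h𝔓 hσ]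
  simp only [Polynomial.map_add, Polynomial.map_sub, Polynomial.map_mul, Polynomial.map_pow, Polynomial.map_X,
    Polynomial.map_C]

/-- **CONG ⇒ MOD, granted Deligne's theorem** (`DeligneSerre1974.thm61_exists_adicGaloisRep`, Deligne 1971 ∕ Deligne–Serre
1974 Thm. 6.1, a NAMED FACT of the tree): the congruent newform `f` of level prime to `q` carries `ρ̄_{V,3}`.  Proof, all
from the tree: `ρ̄_{f,λ} : Γ_ℚ → GL₂(k)` semisimple with `IsGaloisRepOfNewform1Int f ι_f {ℓ ∣ 3 M_f} ρ̄_{f,λ}`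
(`exists_isGaloisRepOfNewform1Int_semisimple_of_thm61`); `ρ̄_{V,3} ⊗_j k` semisimple (`isSemisimple_baseChange_of_surj`);
at all but finitely many places (good for `V`, prime to `3 M_f`, and in the congruence set) both have the Frobenius
polynomial `ι_f(P_v) = X² − j(ā_v) X + j(#k_v)` (the integral Hecke polynomial is unique: `𝓞_f → K_f` is injective);
hence `ρ̄_{f,λ} ≅ ρ̄_{V,3} ⊗ k` (Čebotarev + Brauer–Nesbitt, `nonempty_equiv_of_hasFrobCharpolyAt_eventually_of_discrete'`)
and the predicate transports (`IsGaloisRepOfNewform1Int.of_equiv`).  (Darmon–Diamond–Taylor 1995, §2.1 and p. 87;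
Diamond–Shurman §9.6.) [cite: DeligneSerre1974, Thm. 6.1, Lemme 3.2] [cite: DarmonDiamondTaylor1995, §2.1] -/
theorem modular_of_congruentNewform (h61 : DeligneSerre1974.thm61_exists_adicGaloisRep)
    (hCONG : CongruentNewformOfLevelPrimeToCartanPlaceAtThree) : ModularOfLevelPrimeToCartanPlaceAtThree := by
  intro V _ hS N D M C q _ X W₁ _ Q hq hN hDMC hq3 hmin c χ hχΛ hχadd hχres hne
  obtain ⟨Mf, hMf, f, hf, k, _, _, _, j, ιf, hqMf, hcong⟩ :=
    hCONG V hS N D M C q X W₁ Q hq hN hDMC hq3 hmin c χ hχΛ hχadd hχres hne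
  obtain ⟨ρ, hρ⟩ := V.exists_isTorsionGaloisRep 3
  haveI : CharP k 3 := charP_of_injective_ringHom j.injective 3
  obtain ⟨ρf, hgalf, hssf⟩ :=
    DeligneSerre1974.exists_isGaloisRepOfNewform1Int_semisimple_of_thm61 h61 le_rfl hf 3 ιf
  have hssV := isSemisimple_baseChange_of_surj hS hρ k j
  -- the three cofinite conditions besides the congruence
  have hgood := V.eventually_hasGoodReductionAt (K := ℚ)
  have h3fin : ∀ᶠ v : HeightOneSpectrum (𝓞 ℚ) in Filter.cofinite, ((3 : ℕ) : 𝓞 ℚ) ∉ v.asIdeal := by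
    rw [Filter.eventually_cofinite]
    simp only [not_not]
    exact HeightOneSpectrum.finite_setOf_natCast_mem (by norm_num)
  have hSfin : ∀ᶠ v : HeightOneSpectrum (𝓞 ℚ) in Filter.cofinite, ((primesEquiv v : Nat.Primes) : ℕ) ∉ {ℓ | ℓ ∣ Mf * 3} := by
    rw [Filter.eventually_cofinite]
    simp only [not_not]
    refine (HeightOneSpectrum.finite_setOf_natCast_mem (R := 𝓞 ℚ) (ℓ := Mf * 3)
      (mul_ne_zero (NeZero.ne Mf) (by norm_num))).subset fun v hv ↦ ?_
    rw [Set.mem_setOf_eq, CartanCarayol.natCast_mem_asIdeal_iff_natGenerator_dvd]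
    exact hv
  have hev : ∀ᶠ v : HeightOneSpectrum (𝓞 ℚ) in Filter.cofinite, ∃ P : Polynomial k,
      ρf.HasFrobCharpolyAt v P ∧
        FramedGaloisRep.HasFrobCharpolyAt v P (FramedRep.baseChange j continuous_of_discreteTopology ρ) := by
    filter_upwards [hcong, hgood, h3fin, hSfin] with v hPv hv h3v hvS
    obtain ⟨P, hP, hPj⟩ := hPv
    obtain ⟨-, P', hP', hchar⟩ := hgalf v hvS
    have hPP' : P' = P :=
      Polynomial.map_injective _ (NumberField.RingOfIntegers.coe_injective) (hP'.trans hP.symm)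
    refine ⟨P.map ιf, ?_, ?_⟩
    · rw [← hPP']
      exact hchar
    · rw [hPj]
      exact hasFrobCharpolyAt_baseChange_of_isTorsionGaloisRep hρ k j hv h3v
  obtain ⟨e⟩ := FramedGaloisRep.nonempty_equiv_of_hasFrobCharpolyAt_eventually_of_discrete' ρf
    (FramedRep.baseChange j continuous_of_discreteTopology ρ) hssf hssV hev
  exact ⟨ρ, hρ, Mf, hMf, 2, f, k, inferInstance, inferInstance, inferInstance, j, ιf, hqMf, hgalf.of_equiv e⟩

/-- CONG ⇒ OBS, granted Deligne's theorem. -/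
theorem noModThreePeriodCharacterExtension_of_congruentNewform (h61 : DeligneSerre1974.thm61_exists_adicGaloisRep)
    (hCONG : CongruentNewformOfLevelPrimeToCartanPlaceAtThree) : CartanCover.Charext.NoModThreePeriodCharacterExtension :=
  noModThreePeriodCharacterExtension_of_modular (modular_of_congruentNewform h61 hCONG)

/-- `(M) → (M0) → CONG → D4`, granted Deligne's theorem. -/
theorem saturationAtThree_of_congruentNewform (h61 : DeligneSerre1974.thm61_exists_adicGaloisRep)
    (hM : CartanCover.PeriodLatticeCharacter) (hM0 : CartanCover.Charext.StrongApproxAtCartanPlace)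
    (hCONG : CongruentNewformOfLevelPrimeToCartanPlaceAtThree) : CartanCover.SaturationAtThree :=
  saturationAtThree_of_modular hM hM0 (modular_of_congruentNewform h61 hCONG)

end Summit.BirchSwinnertonDyer.BirchSwinnertonDyer.Theorems.CartanCarayol

end
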